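import Mathlib

/-!
# Crux `TateFamilyKernel` (stmt-KontsevichZagierPeriods-9130), line `Sketch` — `stub_towerSplit`
# (wave 15 seed, lead c4: the `θ`-tower of the face family splits into the two faces)

For the Euler sector of the lead's skeleton of the crux
`Summit.KontsevichZagierPeriods.KontsevichZagierPeriods.Theses.InverseLandau.TateFamilyKernel`:
at the `(s,ϖ)`-level (`X 0 = s`, `X 1 = ϖ`) the face family of a quasi-homogeneous pencil is
`N_w/D₂` with `D₂ = D_a·D_b`, `D_a = 1 − ϖT(1,s)`, `D_b = 1 − ϖT(s,1)`,
`N_w = a·P_w(1,s)·D_b + b·P_w(s,1)·D_a`, i.e. `N_w/D₂ = aP_w(1,s)/D_a + bP_w(s,1)/D_b`. The operator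
`θ = ϖ∂_ϖ` is additive and preserves each summand, so the `θ`-tower `Ns w i/D₂^{i+1} = θ^i(N_w/D₂)`
(recursion `Ns w (i+1) = X₁(∂₁(Ns w i)·D₂ − (i+1)·Ns w i·∂₁D₂)`) is the sum of the two one-face towers
`NAs w i/D_a^{i+1}` and `NBs w i/D_b^{i+1}`; in polynomial form
`Ns w i = NAs w i · D_b^{i+1} + NBs w i · D_a^{i+1}`. This is the bookkeeping that lets the
(C′)-chain (Hermite reduction, Stieltjes densities) treat the two faces separately.
Mathlib only; no named fact, no new definition.
-/

noncomputable section

open MeasureTheory Set MvPolynomial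

namespace Summit.KontsevichZagierPeriods.InverseLandau.TateFamilyKernel.Descent

namespace TowerSplit

/-- One `θ`-step splits: if `Ns = A·Db^{i+1} + B·Da^{i+1}` then
`X₁(∂₁Ns·(DaDb) − (i+1)Ns·∂₁(DaDb)) = [X₁(∂₁A·Da − (i+1)A∂₁Da)]·Db^{i+2} + [X₁(∂₁B·Db − (i+1)B∂₁Db)]·Da^{i+2}`
(Leibniz rule; the mixed terms cancel). [folklore] -/
theorem step {σ : Type*} (j : σ) (A B Da Db : MvPolynomial σ ℚ) (i : ℕ) :
    X j * (pderiv j (A * Db ^ (i + 1) + B * Da ^ (i + 1)) * (Da * Db) -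
        C ((i : ℚ) + 1) * (A * Db ^ (i + 1) + B * Da ^ (i + 1)) * pderiv j (Da * Db)) =
      X j * (pderiv j A * Da - C ((i : ℚ) + 1) * A * pderiv j Da) * Db ^ (i + 1 + 1) +
        X j * (pderiv j B * Db - C ((i : ℚ) + 1) * B * pderiv j Db) * Da ^ (i + 1 + 1) := by
  simp only [Derivation.leibniz, Derivation.leibniz_pow, map_add, smul_eq_mul, nsmul_eq_mul,
    Nat.cast_add, Nat.cast_one, Nat.add_sub_cancel]
  simp only [map_natCast, map_one]
  ring

end TowerSplit

/-- **The `θ`-tower of the face family splits into the two faces** (wave 15 seed of the lead's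
skeleton): with `D_a = 1 − ϖT(1,s)`, `D_b = 1 − ϖT(s,1)` (`X 0 = s`, `X 1 = ϖ`), the `θ = ϖ∂_ϖ`-towers
`Ns` (denominator `D_aD_b`, seed `aP_w(1,s)D_b + bP_w(s,1)D_a`), `NAs` (denominator `D_a`, seed
`aP_w(1,s)`) and `NBs` (denominator `D_b`, seed `bP_w(s,1)`) satisfy
`Ns w i = NAs w i · D_b^{i+1} + NBs w i · D_a^{i+1}`, i.e. `Ns w i/(D_aD_b)^{i+1} = NAs w i/D_a^{i+1} + NBs w i/D_b^{i+1}`.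
[folklore: `θ` is additive] -/
theorem stub_towerSplit (a b : ℕ) (T : MvPolynomial (Fin 2) ℚ) (Pw : ℕ → MvPolynomial (Fin 2) ℚ)
    (Ns NAs NBs : ℕ → ℕ → MvPolynomial (Fin (1 + 1)) ℚ)
    (hNs0 : ∀ w, Ns w 0 =
      C (a : ℚ) * bind₁ ![C 1, X 0] (Pw w) * (1 - X 1 * bind₁ ![X 0, C 1] T) +
        C (b : ℚ) * bind₁ ![X 0, C 1] (Pw w) * (1 - X 1 * bind₁ ![C 1, X 0] T))
    (hNsS : ∀ w i, Ns w (i + 1) =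
      X 1 * (pderiv 1 (Ns w i) * ((1 - X 1 * bind₁ ![C 1, X 0] T) * (1 - X 1 * bind₁ ![X 0, C 1] T)) -
        C ((i : ℚ) + 1) * Ns w i * pderiv 1 ((1 - X 1 * bind₁ ![C 1, X 0] T) * (1 - X 1 * bind₁ ![X 0, C 1] T))))
    (hNA0 : ∀ w, NAs w 0 = C (a : ℚ) * bind₁ ![C 1, X 0] (Pw w))
    (hNAS : ∀ w i, NAs w (i + 1) =
      X 1 * (pderiv 1 (NAs w i) * (1 - X 1 * bind₁ ![C 1, X 0] T) -
        C ((i : ℚ) + 1) * NAs w i * pderiv 1 (1 - X 1 * bind₁ ![C 1, X 0] T)))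
    (hNB0 : ∀ w, NBs w 0 = C (b : ℚ) * bind₁ ![X 0, C 1] (Pw w))
    (hNBS : ∀ w i, NBs w (i + 1) =
      X 1 * (pderiv 1 (NBs w i) * (1 - X 1 * bind₁ ![X 0, C 1] T) -
        C ((i : ℚ) + 1) * NBs w i * pderiv 1 (1 - X 1 * bind₁ ![X 0, C 1] T))) :
    ∀ w i, (Ns w i : MvPolynomial (Fin (1 + 1)) ℚ) =
      NAs w i * (1 - X 1 * bind₁ ![X 0, C 1] T) ^ (i + 1) + NBs w i * (1 - X 1 * bind₁ ![C 1, X 0] T) ^ (i + 1) := by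
  intro w i
  induction i with
  | zero =>
    rw [hNs0, hNA0, hNB0, zero_add, pow_one, pow_one]
  | succ i ih =>
    rw [hNsS, ih, hNAS, hNBS, TowerSplit.step]

end Summit.KontsevichZagierPeriods.InverseLandau.TateFamilyKernel.Descent

end
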